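import Summits.ResolutionOfSingularities.ResolutionOfSingularities.Theorems.WildConesCampaignW46AtomChart
import Literature.AlgebraicGeometry.Resolution.CompletionBaseChange
import HarnessLib

/-!
# [OURS · L1 W4.6, rungs (i)/(ii) — the dictionary, SCHEME HALF, brick 9] Orders through the dictionary, and the
# `z`-chart: the transform of an atom has order `≥ p` at the new point iff the successor state has multiplicity
# `p`; over the `z`-chart point with all `u_j/z = 0` the transform is a unit

Cell res-hironaka (LADDER-RESOLUTION rung L, D-0089), slot W4.6, seat res-L1-s46-pv-2 (gen 2). Host: route
`WildCones`, crux `ClassicalRegimes` (stmt-ResolutionOfSingularities-16884), `--supports … --as helper`.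

HONEST FRAMING. Everything here is OURS — commutative algebra composing bricks 1–8 of this seat with the tree's
`mem_map_pow_adicCompletion_iff` (Stacks 05GG, `CompletionBaseChange.lean`). NOTHING here is a statement of
H. Hironaka's manuscript [Hironaka2017]; no FACT-LIST premise. AI review is weaker than expert review.

## Contents

* `mem_maximalIdeal_pow_iff_algebraMap` — `a ∈ 𝔪_L^k ⟺ a ∈ 𝔪_{L̂}^k` (completion is faithful on the `𝔪`-adic
  filtration); `mem_maximalIdeal_pow_iff_of_ringEquiv` — read through an isomorphism `E′ : L̂ ≅ κ⟦X⟧` and a unit.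
* `transform_mem_pow_iff_multP` — under the conclusion of brick 8 (`E′(f′) = unit · (z^p − ser c′)`, `c′` the
  successor state): **`f′ ∈ 𝔪_L^p ⟺ ser c′ ∈ 𝔪^p`**, i.e. (`AtomGerm.multP_iff_atom_mem`) the new point lies in
  the top locus `{ord ≥ p}` of the transform iff the successor state has multiplicity `p` or is zero — the
  dictionary for `MultP`, which is how «`ξ′ ∈ Sing(E′)`» of the typed procedure is read on the coefficient side.
* `not_mem_maximalIdeal_transform_of_zChart` — if the point lies in the `z`-chart with all coordinates
  `u_j/z ∈ 𝔪` (the point `(1 : 0 : … : 0)` of the exceptional divisor), the transform of an atom of multiplicity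
  `p` is a UNIT: that point is never on the transform. Hence every point of the transform over the centre lies in
  some `u`-chart — the coefficient dynamics (which only has `u`-charts) loses nothing.

References: bricks 1–8 of this seat; The Stacks Project, Tag 05GG. [StacksProject] [folklore]
-/

noncomputable section

-- single-problem summit: the doubled namespace component `ResolutionOfSingularities` is forced
set_option linter.dupNamespace false

open scoped BigOperators Classical
open MvPowerSeries IsLocalRing

namespace Summit.ResolutionOfSingularities.ResolutionOfSingularities.Theorems

namespace CampaignW46.AtomGerm

open WildCones
open CampaignW46.FormalDictionary
open CampaignW46.FormalChart
open Summit.ResolutionOfSingularities.ResolutionOfSingularities.Theorems.FrobeniusClosing (chartSubst)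
open Literature.AlgebraicGeometry.Resolution
open Literature.RingTheory.MvPowerSeries.Jets (maximalIdeal_pow_eq_span_monomial
  mem_maximalIdeal_iff_constantCoeff_eq_zero)

variable {n : ℕ} {κ : Type} [Field κ] {p : ℕ}

/-! ## Substitutions with values in an ideal -/

/-- A substitution all of whose values lie in an ideal `I` takes `𝔪^k` into `I^k`. [folklore] -/
theorem subst_mem_pow_of_mem_maximalIdeal_pow {ι : Type} [Fintype ι] {a : ι → MvPowerSeries (Option (Fin n)) κ}
    (ha : HasSubst a) {I : Ideal (MvPowerSeries (Option (Fin n)) κ)} (haI : ∀ j, a j ∈ I) {k : ℕ}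
    {h : MvPowerSeries ι κ} (hh : h ∈ maximalIdeal (MvPowerSeries ι κ) ^ k) : subst a h ∈ I ^ k := by
  rw [maximalIdeal_pow_eq_span_monomial] at hh
  induction hh using Submodule.span_induction with
  | mem y hy =>
    obtain ⟨e, he, rfl⟩ := hy
    rw [subst_monomial ha, map_one, one_mul, Finsupp.prod, ← show e.degree = k from he, Finsupp.degree_apply,
      ← Finset.prod_pow_eq_pow_sum]
    exact Ideal.prod_mem_prod fun j _ => Ideal.pow_mem_pow (haI j) _
  | zero => rw [← substAlgHom_apply ha, map_zero]; exact Ideal.zero_mem _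
  | add y z _ _ hy hz => rw [← substAlgHom_apply ha, map_add, substAlgHom_apply, substAlgHom_apply]; exact Ideal.add_mem _ hy hz
  | smul b y _ hy =>
    rw [smul_eq_mul, ← substAlgHom_apply ha, map_mul, substAlgHom_apply, substAlgHom_apply]
    exact Ideal.mul_mem_left _ _ hy

/-- Under a substitution fixing `X i` whose values are multiples of `X i`, a series adapted to `X i` to first order
goes to `X i` times a unit (index-general form of `exists_isUnit_image_adapted`). [folklore] -/
theorem exists_isUnit_image_adapted' (i : Option (Fin n)) {a : Option (Fin n) → MvPowerSeries (Option (Fin n)) κ}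
    (ha : HasSubst a) (hai : a i = X i) (hax : ∀ j, a j ∈ Ideal.span {(X i : MvPowerSeries (Option (Fin n)) κ)})
    (x : MvPowerSeries (Option (Fin n)) κ)
    (hx : x - X i ∈ maximalIdeal (MvPowerSeries (Option (Fin n)) κ) ^ 2) :
    ∃ w : MvPowerSeries (Option (Fin n)) κ, IsUnit w ∧ subst a x = X i * w := by
  have h2 := subst_mem_pow_of_mem_maximalIdeal_pow ha hax hx
  rw [Ideal.span_singleton_pow] at h2
  obtain ⟨b, hb⟩ := Ideal.mem_span_singleton'.1 h2
  refine ⟨1 + X i * b, ?_, ?_⟩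
  · rw [MvPowerSeries.isUnit_iff_constantCoeff, map_add, map_one, map_mul, constantCoeff_X, zero_mul, add_zero]
    exact isUnit_one
  · have h1 : subst a x = subst a (x - X i) + subst a (X i : MvPowerSeries (Option (Fin n)) κ) := by
      rw [← substAlgHom_apply ha, ← substAlgHom_apply ha, ← substAlgHom_apply ha, ← map_add, sub_add_cancel]
    rw [h1, ← hb, subst_X ha, hai]
    ring

/-! ## Orders are read through the completion and the recognition -/

/-- **Completion is faithful on the `𝔪`-adic filtration**: `a ∈ 𝔪_L^k ⟺ a ∈ 𝔪_{L̂}^k`. [cite: StacksProject, Tag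
05GG] [folklore] -/
theorem mem_maximalIdeal_pow_iff_algebraMap {L : Type} [CommRing L] [IsLocalRing L] [IsNoetherianRing L] (k : ℕ)
    (a : L) :
    a ∈ maximalIdeal L ^ k ↔ algebraMap L (AdicCompletion (maximalIdeal L) L) a ∈
      maximalIdeal (AdicCompletion (maximalIdeal L) L) ^ k := by
  rw [AdicCompletion.maximalIdeal_eq_map, ← Ideal.map_pow]
  constructor
  · exact fun h => Ideal.mem_map_of_mem _ h
  · intro ha
    rw [mem_map_pow_adicCompletion_iff _ (maximalIdeal L).fg_of_isNoetherianRing, AdicCompletion.algebraMap_apply,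
      Algebra.algebraMap_self, RingHom.id_apply, AdicCompletion.evalₐ_of, Ideal.Quotient.eq_zero_iff_mem] at ha
    exact ha

/-- Orders read through an isomorphism `E′ : L̂ ≅ κ⟦X⟧` and a unit: if `E′(a) = w · A` with `w` a unit, then
`a ∈ 𝔪_L^k ⟺ A ∈ 𝔪^k`. [folklore] -/
theorem mem_maximalIdeal_pow_iff_of_ringEquiv {L : Type} [CommRing L] [IsLocalRing L] [IsNoetherianRing L]
    (E' : AdicCompletion (maximalIdeal L) L ≃+* MvPowerSeries (Option (Fin n)) κ) {a : L}
    {w A : MvPowerSeries (Option (Fin n)) κ} (hw : IsUnit w)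
    (hE : E' (algebraMap L (AdicCompletion (maximalIdeal L) L) a) = w * A) (k : ℕ) :
    a ∈ maximalIdeal L ^ k ↔ A ∈ maximalIdeal (MvPowerSeries (Option (Fin n)) κ) ^ k := by
  rw [mem_maximalIdeal_pow_iff_algebraMap, ← Ideal.unit_mul_mem_iff_mem _ hw, ← hE]
  constructor
  · exact fun h => ringEquiv_mem_maximalIdeal_pow E' h
  · intro h
    have := ringEquiv_mem_maximalIdeal_pow E'.symm h
    rwa [RingEquiv.symm_apply_apply] at this

/-- [OURS · L1 W4.6 — DICTIONARY for the multiplicity predicate after a step; replaces the role of «`ξ′ ∈ Sing(E′)`,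
`E′ = (J′, b)` the transform» (H. Hironaka, ms. 2017, Th. 16.6 p.84, §2 p.4) for the transform of an atom; NOT a
statement of the manuscript] Under the conclusion of brick 8 (`E′(f′) = w′ · (z^p − ser c′)`): **`f′ ∈ 𝔪_L^p ⟺
ser c′ ∈ 𝔪^p`**, and `MultP c′ ⟺ ser c′ ≠ 0 ∧ f′ ∈ 𝔪_L^p`. [folklore] -/
theorem transform_mem_pow_iff_multP {L : Type} [CommRing L] [IsLocalRing L] [IsNoetherianRing L]
    (E' : AdicCompletion (maximalIdeal L) L ≃+* MvPowerSeries (Option (Fin n)) κ) {f' : L}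
    {w' : MvPowerSeries (Option (Fin n)) κ} (hw' : IsUnit w') (c' : (Fin n → ℕ) → κ)
    (hE : E' (algebraMap L (AdicCompletion (maximalIdeal L) L) f') =
      w' * ((X none : MvPowerSeries (Option (Fin n)) κ) ^ p - rename (some : Fin n → Option (Fin n)) (ser p n κ c'))) :
    (f' ∈ maximalIdeal L ^ p ↔ ser p n κ c' ∈ maximalIdeal (MvPowerSeries (Fin n) κ) ^ p) ∧
      (MultP p n κ c' ↔ ser p n κ c' ≠ 0 ∧ f' ∈ maximalIdeal L ^ p) := by
  have h1 := mem_maximalIdeal_pow_iff_of_ringEquiv E' hw' hE p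
  rw [atom_mem_maximalIdeal_pow_iff] at h1
  refine ⟨h1, ?_⟩
  rw [multP_iff_atom_mem, atom_mem_maximalIdeal_pow_iff, h1]

/-! ## The `z`-chart point `(1 : 0 : … : 0)` is never on the transform -/

section ZChart

variable [Fact p.Prime] [CharP κ p]
  {R : Type} [CommRing R] [IsLocalRing R] [IsNoetherianRing R]
  {L : Type} [CommRing L] [IsLocalRing L] [IsNoetherianRing L]
  (g : R →+* L) (hg : (maximalIdeal R).map g ≤ maximalIdeal L)
  (E₀ : AdicCompletion (maximalIdeal R) R ≃+* MvPowerSeries (Option (Fin n)) κ)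
  (c : Option (Fin n) → R) (hc : Ideal.span (Set.range c) = maximalIdeal R)
  (hcX : ∀ j, E₀ (algebraMap R (AdicCompletion (maximalIdeal R) R) (c j)) - X j ∈
    maximalIdeal (MvPowerSeries (Option (Fin n)) κ) ^ 2)
  (e : Option (Fin n) → L) (he : ∀ j, g (c j) = g (c none) * e j)
  (τ : Option (Fin n) → R)
  (hgen : Ideal.span (Set.range fun j : Option (Fin n) =>
    if j = none then g (c none) else e j - g (τ j)) = maximalIdeal L)
  (hres : ∀ y : L, ∃ r : R, y - g r ∈ maximalIdeal L)
  (hdim : (Fintype.card (Option (Fin n)) : WithBot ℕ∞) ≤ ringKrullDim L)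

include hg hc he hcX hgen hres hdim in
omit [CharP κ p] in
/-- [OURS · L1 W4.6 — DICTIONARY, the `z`-CHART; replaces the role of «the closed points `ξ′ ∈ π⁻¹(ξ)` of the
blowup at which the transform has order `≥ b`» (H. Hironaka, ms. 2017, Th. 16.6 p.84 l.10) for an atom of
multiplicity `p`: the point of the exceptional divisor in the chart `z` with all `u_j/z ≡ 0` is NOT on the transform;
NOT a statement of the manuscript] **In the `z`-chart with all `τ̃_j ∈ 𝔪_R`, the transform of an atom of multiplicity
`p` is a unit**: if `g f₀ = g(c_none)^p · f′` then `f′ ∉ 𝔪_L`. (Reason: read through the chart `z ↦ z`,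
`u_j ↦ z u_j`, the atom `z^p − a(u)` becomes `z^p (1 − ã)` with `ã ∈ 𝔪`, because `ord a ≥ p`.) [folklore] -/
theorem not_mem_maximalIdeal_transform_of_zChart (hτ𝔪 : ∀ j : Fin n, τ (some j) ∈ maximalIdeal R)
    (c₀ : (Fin n → ℕ) → κ) (hM : MultP p n κ c₀) (f₀ : R) (w₀ : MvPowerSeries (Option (Fin n)) κ)
    (hw₀ : IsUnit w₀)
    (hf₀ : E₀ (algebraMap R (AdicCompletion (maximalIdeal R) R) f₀) =
      w₀ * ((X none : MvPowerSeries (Option (Fin n)) κ) ^ p - rename (some : Fin n → Option (Fin n)) (ser p n κ c₀)))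
    (f' : L) (hf' : g f₀ = g (c none) ^ p * f') : f' ∉ maximalIdeal L := by
  -- notation
  set ĝ := adicCompletionMap (maximalIdeal R) (maximalIdeal L) g hg with hĝ
  set φ : MvPowerSeries (Option (Fin n)) κ →+* AdicCompletion (maximalIdeal L) L := ĝ.comp E₀.symm.toRingHom with hφ
  set ofL := algebraMap L (AdicCompletion (maximalIdeal L) L) with hofL
  set ofR := algebraMap R (AdicCompletion (maximalIdeal R) R) with hofR
  have hφE₀ : ∀ x, φ (E₀ x) = ĝ x := fun x => by
    rw [hφ, RingHom.comp_apply]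
    change ĝ (E₀.symm (E₀ x)) = ĝ x
    rw [RingEquiv.symm_apply_apply]
  have hĝ_of : ∀ x : R, ĝ (ofR x) = ofL (g x) := fun x => by
    rw [hofR, hofL, hĝ, adicCompletionMap_algebraMap]
  -- the coordinates of the point vanish
  have hτ0 : ∀ j : Option (Fin n), j ≠ none → constantCoeff (E₀ (ofR (τ j))) = 0 := by
    intro j hj
    obtain ⟨k, rfl⟩ := Option.ne_none_iff_exists'.1 hj
    refine mem_maximalIdeal_iff_constantCoeff_eq_zero.1 (ringEquiv_mem_maximalIdeal E₀ ?_)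
    rw [hofR, AdicCompletion.maximalIdeal_eq_map]
    exact Ideal.mem_map_of_mem _ (hτ𝔪 k)
  haveI : IsNoetherianRing (AdicCompletion (maximalIdeal L) L) := isNoetherianRing_adicCompletion_maximalIdeal L
  -- the plain chart at index `none`
  obtain ⟨E, hEC, hEi, hEj⟩ :=
    exists_ringEquiv_completion_chart g hg E₀ c hc hcX none e he τ hgen hres hdim
  set σ : Option (Fin n) → MvPowerSeries (Option (Fin n)) κ := fun j =>
    if j = none then X none else X none * (X j + MvPowerSeries.C (0 : κ)) with hσ
  have hσsub : HasSubst σ := hasSubst_chart none (fun _ : Option (Fin n) => (0 : κ))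
  have hEφ : ∀ f, E (φ f) = subst σ f := by
    intro f
    refine ringHom_eq_subst_of_apply_X ((E : _ →+* MvPowerSeries (Option (Fin n)) κ).comp φ) hEC none
      (fun _ : Option (Fin n) => (0 : κ)) hEi (fun j hj => ?_) f
    rw [RingHom.comp_apply]
    change E (φ (X j)) = _
    rw [hEj j hj, hτ0 j hj]
  have hσi : σ none = X none := by rw [hσ]; simp
  have hσX : ∀ j, σ j ∈ Ideal.span {(X none : MvPowerSeries (Option (Fin n)) κ)} := by
    intro j
    by_cases hj : j = none
    · rw [hσ]; simp only [hj, if_true]; exact Ideal.subset_span rfl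
    · rw [hσ]; simp only [if_neg hj]; exact Ideal.mul_mem_right _ _ (Ideal.subset_span rfl)
  -- the placed `u`-variables go into `z · 𝔪`
  have hσsome : ∀ j : Fin n, σ (some j) ∈ Ideal.span {(X none : MvPowerSeries (Option (Fin n)) κ)} *
      maximalIdeal (MvPowerSeries (Option (Fin n)) κ) := by
    intro j
    rw [hσ]
    simp only [Option.some_ne_none, if_false, map_zero, add_zero]
    exact Ideal.mul_mem_mul (Ideal.subset_span rfl)
      (mem_maximalIdeal_iff_constantCoeff_eq_zero.2 (constantCoeff_X _))
  -- `σ(a) = z^p · m` with `m ∈ 𝔪` since `ord a ≥ p`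
  have ha𝔪 : ser p n κ c₀ ∈ maximalIdeal (MvPowerSeries (Fin n) κ) ^ p :=
    (atom_mem_maximalIdeal_pow_iff (ser p n κ c₀)).1 ((multP_iff_atom_mem c₀).1 hM).2
  have hσa : subst σ (rename (some : Fin n → Option (Fin n)) (ser p n κ c₀)) ∈
      Ideal.span {(X none : MvPowerSeries (Option (Fin n)) κ) ^ p} * maximalIdeal (MvPowerSeries (Option (Fin n)) κ) := by
    rw [rename_some_eq_subst, subst_comp_subst_apply hasSubst_X_some hσsub]
    have hb : HasSubst (fun j : Fin n => subst σ (X (some j) : MvPowerSeries (Option (Fin n)) κ)) :=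
      hasSubst_of_constantCoeff_zero fun j => by
        rw [subst_X hσsub, hσ]
        simp
    have h1 := subst_mem_pow_of_mem_maximalIdeal_pow hb (fun j => by rw [subst_X hσsub]; exact hσsome j) ha𝔪
    rw [mul_pow, Ideal.span_singleton_pow] at h1
    have hp0 : p ≠ 0 := (Fact.out : p.Prime).ne_zero
    exact Ideal.mul_mono_right (Ideal.pow_le_self hp0) h1
  obtain ⟨m, hm, hσa'⟩ := Ideal.mem_span_singleton_mul.1 hσa
  -- `E (g f₀) = σ(w₀) · z^p · (1 − m)`
  have hatom : subst σ ((X none : MvPowerSeries (Option (Fin n)) κ) ^ p -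
      rename (some : Fin n → Option (Fin n)) (ser p n κ c₀)) = X none ^ p - X none ^ p * m := by
    rw [← substAlgHom_apply hσsub, map_sub, map_pow, substAlgHom_apply, substAlgHom_apply, subst_X hσsub, hσi,
      ← hσa']
  have hEgf₀ : E (ofL (g f₀)) = subst σ w₀ * (X none ^ p * (1 - m)) := by
    rw [← hĝ_of, ← hφE₀, hf₀, map_mul, map_mul, hEφ, hEφ, hatom]
    ring
  -- `E (g c_none) = z · unit`
  obtain ⟨w₁, hw₁, hEci⟩ : ∃ w₁ : MvPowerSeries (Option (Fin n)) κ, IsUnit w₁ ∧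
      E (ofL (g (c none))) = X none * w₁ := by
    obtain ⟨w₁, hw₁, h⟩ := exists_isUnit_image_adapted' none hσsub hσi hσX (E₀ (ofR (c none))) (hcX none)
    exact ⟨w₁, hw₁, by rw [← hĝ_of, ← hφE₀, hEφ, h]⟩
  -- hence `E f′` is a unit
  have hX0 : (X none : MvPowerSeries (Option (Fin n)) κ) ≠ 0 := by
    intro h
    have := congrArg (coeff (Finsupp.single none 1)) h
    rw [coeff_X, if_pos rfl, map_zero] at this
    exact one_ne_zero this
  have hEf' : w₁ ^ p * E (ofL f') = subst σ w₀ * (1 - m) := by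
    have h1 : E (ofL (g f₀)) = (X none * w₁) ^ p * E (ofL f') := by
      rw [hf', map_mul, map_pow, map_mul, map_pow, hEci]
    have h2 : (X none : MvPowerSeries (Option (Fin n)) κ) ^ p * (w₁ ^ p * E (ofL f')) =
        X none ^ p * (subst σ w₀ * (1 - m)) := by
      rw [← mul_assoc, ← mul_pow, ← h1, hEgf₀]; ring
    exact mul_left_cancel₀ (pow_ne_zero p hX0) h2
  have hunit : IsUnit (E (ofL f')) := by
    have hw₀' : IsUnit (subst σ w₀) := by rw [← substAlgHom_apply hσsub]; exact hw₀.map _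
    have hm' : IsUnit (1 - m) := IsLocalRing.isUnit_one_sub_self_of_mem_nonunits m hm
    have h := hw₀'.mul hm'
    rw [← hEf'] at h
    exact isUnit_of_mul_isUnit_right h
  intro hf'𝔪
  have h1 : E (ofL f') ∈ maximalIdeal (MvPowerSeries (Option (Fin n)) κ) := by
    refine ringEquiv_mem_maximalIdeal E ?_
    rw [hofL, AdicCompletion.maximalIdeal_eq_map]
    exact Ideal.mem_map_of_mem _ hf'𝔪
  exact (IsLocalRing.mem_maximalIdeal _ |>.1 h1) hunit

end ZChart

end CampaignW46.AtomGerm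

end Summit.ResolutionOfSingularities.ResolutionOfSingularities.Theorems

end
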